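import Literature.Analysis.InverseSpectral.KreinString
import HarnessLib

/-!
# Kreĭn strings: the fundamental system of the string equation (proofs)

This file discharges the named fact `KreinStringFundamentalSystem` of
`Literature/Analysis/InverseSpectral/KreinString.lean`: for every Kreĭn string `S[m, L]` and every
`z ∈ ℂ`, the Picard series `φ(·, z) = ∑ₙ (-z)ⁿ φₙ`, `ψ(·, z) = ∑ₙ (-z)ⁿ ψₙ`
(`KreinString.phi`, `KreinString.psi`) are continuous solutions on `[0, L)` of the string equation
`dy' + z y dm = 0` in the integral form `y(x) = y(0) + y'(0-) x - z ∫_{[0,x]} (x - s) y(s) dm(s)`,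
and a continuous solution is uniquely determined by `(y(0), y'(0-))`.

## Proof

Picard iteration for a Volterra–Stieltjes equation (Kac–Kreĭn 1974 §1, Arov–Dym 2012 §2.6).
Write `(K u)(x) = ∫_{[0,x]} (x - t) u(t) dm(t)` (`KreinString.picard` iterates `K`). For
`x₀ ∈ [0, L)` the measure `dm` is finite on `[0, x₀]`, say of mass `M`, and the elementary
inequality `(s - t) tⁿ ≤ sⁿ⁺¹/(n+1)` (`0 ≤ t ≤ s`, `KreinString.sub_mul_pow_le`) gives the kernel
estimate `‖K u (s)‖ ≤ K M sⁿ⁺¹/(n+1)` whenever `‖u(t)‖ ≤ K tⁿ` on `[0, x₀]`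
(`KreinString.norm_integral_kernel_le`). Hence `|Kⁿ f| ≤ C (M s)ⁿ/n!` (`abs_picard_le`), the
iterates are continuous (`continuousOn_picard`, dominated convergence), the Picard series
converges uniformly on `[0, x₀]` (`continuousOn_picardSeries`) and may be integrated termwise
(`picardSeries_eq`), which is the integral equation. Uniqueness (`IsSolution.eqOn`) is the
Grönwall iteration `‖w(s)‖ ≤ W (|z| M s)ⁿ/n! → 0` for the difference `w` of two solutions, using
the same kernel estimate.

## References

KacKrein1974 (§1), ArovDym2012 (§2.6, eq. (2.61)).
-/

open MeasureTheory Filter Set Topology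
open scoped ENNReal Nat

noncomputable section

namespace Literature.Analysis.InverseSpectral

namespace KreinString

variable (S : KreinString)

/-- `dm([0, x]) < ∞` for `x ∈ [0, L)`. [folklore] -/
lemma massMeasure_Icc_lt_top {x : ℝ} (hx : x ∈ S.dom) : S.massMeasure (Icc 0 x) < ⊤ :=
  (measure_mono Icc_subset_Iic_self).trans_lt (S.massMeasure_Iic_lt_top x hx.2)

/-- `dm` restricted to `[0, x]`, `x ∈ [0, L)`, is a finite measure. [folklore] -/
lemma isFiniteMeasure_restrict_Icc {x : ℝ} (hx : x ∈ S.dom) :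
    IsFiniteMeasure (S.massMeasure.restrict (Icc 0 x)) :=
  isFiniteMeasure_restrict.2 (S.massMeasure_Icc_lt_top hx).ne

/-- `[0, x] ⊆ [0, L)` for `x ∈ [0, L)`. [folklore] -/
lemma Icc_subset_dom {x : ℝ} (hx : x ∈ S.dom) : Icc 0 x ⊆ S.dom := fun _ hs =>
  ⟨hs.1, (ENNReal.ofReal_le_ofReal hs.2).trans_lt hx.2⟩

/-- Every point of `[0, L)` lies strictly below another point of `[0, L)`. [folklore] -/
lemma exists_mem_dom_gt {x : ℝ} (hx : x ∈ S.dom) : ∃ x₀ ∈ S.dom, x < x₀ := by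
  rcases eq_or_ne S.length ⊤ with h | h
  · exact ⟨x + 1, ⟨by linarith [hx.1], by simp [h]⟩, by linarith⟩
  · have hxL : x < S.length.toReal := (ENNReal.ofReal_lt_iff_lt_toReal hx.1 h).1 hx.2
    refine ⟨(x + S.length.toReal) / 2, ⟨by linarith [hx.1], ?_⟩, by linarith⟩
    rw [ENNReal.ofReal_lt_iff_lt_toReal (by linarith [hx.1]) h]
    linarith

/-- A function continuous on `[0, x]`, `x ∈ [0, L)`, is `dm`-integrable on `[0, x]`. [folklore] -/
lemma integrableOn_Icc_of_continuousOn {E : Type*} [NormedAddCommGroup E] {x : ℝ} (hx : x ∈ S.dom)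
    {g : ℝ → E} (hg : ContinuousOn g (Icc 0 x)) : IntegrableOn g (Icc 0 x) S.massMeasure := by
  obtain ⟨C, hC⟩ := isCompact_Icc.exists_bound_of_continuousOn hg
  haveI := S.isFiniteMeasure_restrict_Icc hx
  exact Integrable.mono' (integrable_const C) (hg.aestronglyMeasurable measurableSet_Icc)
    (ae_restrict_of_forall_mem measurableSet_Icc hC)

/-- The elementary inequality `(s - t) tⁿ ≤ sⁿ⁺¹/(n+1)` for `0 ≤ t ≤ s`. [folklore] -/
lemma sub_mul_pow_le {s t : ℝ} (ht : 0 ≤ t) (hts : t ≤ s) (n : ℕ) :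
    (s - t) * t ^ n ≤ s ^ (n + 1) / (n + 1) := by
  have hsum : (n + 1 : ℝ) * t ^ n ≤ ∑ i ∈ Finset.range (n + 1), s ^ i * t ^ (n + 1 - 1 - i) := by
    have hterm : ∀ i ∈ Finset.range (n + 1), t ^ n ≤ s ^ i * t ^ (n + 1 - 1 - i) := by
      intro i hi
      have hi' : i ≤ n := Nat.lt_succ_iff.mp (Finset.mem_range.mp hi)
      calc t ^ n = t ^ i * t ^ (n - i) := by rw [← pow_add, Nat.add_sub_cancel' hi']
        _ ≤ s ^ i * t ^ (n - i) := by gcongr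
        _ = s ^ i * t ^ (n + 1 - 1 - i) := by simp
    calc (n + 1 : ℝ) * t ^ n = ∑ _i ∈ Finset.range (n + 1), t ^ n := by simp
      _ ≤ _ := Finset.sum_le_sum hterm
  have key : (s - t) * t ^ n * (n + 1) ≤ s ^ (n + 1) := by
    have hst : 0 ≤ s - t := sub_nonneg.2 hts
    calc (s - t) * t ^ n * (n + 1) = ((n + 1 : ℝ) * t ^ n) * (s - t) := by ring
      _ ≤ (∑ i ∈ Finset.range (n + 1), s ^ i * t ^ (n + 1 - 1 - i)) * (s - t) :=
          mul_le_mul_of_nonneg_right hsum hst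
      _ = s ^ (n + 1) - t ^ (n + 1) := geom_sum₂_mul s t (n + 1)
      _ ≤ s ^ (n + 1) := sub_le_self _ (pow_nonneg ht _)
  rwa [le_div_iff₀ (by positivity)]

/-- Kernel estimate behind the Picard iteration: if `‖g t‖ ≤ K tⁿ` on `[0, x₀]` (`x₀ ∈ [0, L)`)
then `‖∫_{[0,s]} (s - t) g(t) dm(t)‖ ≤ K · dm([0,x₀]) · sⁿ⁺¹/(n+1)` for every `s ∈ [0, x₀]`.
[folklore] -/
lemma norm_integral_kernel_le {E : Type*} [NormedAddCommGroup E] [NormedSpace ℝ E] {x₀ : ℝ}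
    (hx₀ : x₀ ∈ S.dom) {g : ℝ → E} {K : ℝ} (hK : 0 ≤ K) (n : ℕ)
    (hg : ∀ t ∈ Icc 0 x₀, ‖g t‖ ≤ K * t ^ n) {s : ℝ} (hs : s ∈ Icc 0 x₀) :
    ‖∫ t in Icc 0 s, (s - t) • g t ∂S.massMeasure‖ ≤
      K * (S.massMeasure (Icc 0 x₀)).toReal * s ^ (n + 1) / (n + 1) := by
  have hs0 : 0 ≤ s := hs.1
  have hμs : S.massMeasure (Icc 0 s) ≤ S.massMeasure (Icc 0 x₀) :=
    measure_mono (Icc_subset_Icc_right hs.2)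
  haveI := S.isFiniteMeasure_restrict_Icc (S.Icc_subset_dom hx₀ hs)
  have hbound : ∀ᵐ t ∂S.massMeasure.restrict (Icc 0 s),
      ‖(s - t) • g t‖ ≤ K * s ^ (n + 1) / (n + 1) := by
    refine ae_restrict_of_forall_mem measurableSet_Icc (fun t ht => ?_)
    rw [norm_smul, Real.norm_eq_abs, abs_of_nonneg (sub_nonneg.2 ht.2)]
    calc (s - t) * ‖g t‖ ≤ (s - t) * (K * t ^ n) :=
          mul_le_mul_of_nonneg_left (hg t ⟨ht.1, ht.2.trans hs.2⟩) (sub_nonneg.2 ht.2)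
      _ = K * ((s - t) * t ^ n) := by ring
      _ ≤ K * (s ^ (n + 1) / (n + 1)) :=
          mul_le_mul_of_nonneg_left (sub_mul_pow_le ht.1 ht.2 n) hK
      _ = K * s ^ (n + 1) / (n + 1) := by ring
  calc ‖∫ t in Icc 0 s, (s - t) • g t ∂S.massMeasure‖
      ≤ ∫ _t in Icc 0 s, K * s ^ (n + 1) / (n + 1) ∂S.massMeasure :=
        norm_integral_le_of_norm_le (integrable_const _) hbound
    _ = (S.massMeasure (Icc 0 s)).toReal * (K * s ^ (n + 1) / (n + 1)) := by
        rw [setIntegral_const, smul_eq_mul, measureReal_def]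
    _ ≤ (S.massMeasure (Icc 0 x₀)).toReal * (K * s ^ (n + 1) / (n + 1)) :=
        mul_le_mul_of_nonneg_right
          (ENNReal.toReal_mono (S.massMeasure_Icc_lt_top hx₀).ne hμs) (by positivity)
    _ = K * (S.massMeasure (Icc 0 x₀)).toReal * s ^ (n + 1) / (n + 1) := by ring

/-- The Picard iterates are dominated by the exponential series:
`|picard f n s| ≤ C (dm([0,x₀]) · s)ⁿ / n!` on `[0, x₀]` whenever `|f| ≤ C` on `[0, x₀]`.
[folklore] -/
lemma abs_picard_le {f : ℝ → ℝ} {x₀ C : ℝ} (hx₀ : x₀ ∈ S.dom) (hC : ∀ s ∈ Icc 0 x₀, |f s| ≤ C)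
    (n : ℕ) : ∀ {s : ℝ}, s ∈ Icc 0 x₀ →
      |S.picard f n s| ≤ C * ((S.massMeasure (Icc 0 x₀)).toReal * s) ^ n / n ! := by
  induction n with
  | zero => intro s hs; simpa using hC s hs
  | succ n ih =>
    intro s hs
    set M := (S.massMeasure (Icc 0 x₀)).toReal with hM
    have hM0 : 0 ≤ M := ENNReal.toReal_nonneg
    have hC0 : 0 ≤ C := (abs_nonneg _).trans (hC s hs)
    have hg : ∀ t ∈ Icc 0 x₀, ‖S.picard f n t‖ ≤ C * M ^ n / n ! * t ^ n := by
      intro t ht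
      rw [Real.norm_eq_abs]
      calc |S.picard f n t| ≤ C * (M * t) ^ n / n ! := ih ht
        _ = C * M ^ n / n ! * t ^ n := by rw [mul_pow]; ring
    have key := S.norm_integral_kernel_le hx₀ (by positivity) n hg hs
    simp only [smul_eq_mul, Real.norm_eq_abs] at key
    rw [picard_succ]
    calc |∫ t in Icc 0 s, (s - t) * S.picard f n t ∂S.massMeasure|
        ≤ C * M ^ n / n ! * M * s ^ (n + 1) / (n + 1) := key
      _ = C * (M * s) ^ (n + 1) / (n + 1)! := by
          rw [Nat.factorial_succ]; push_cast; rw [mul_pow]; field_simp; ring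

/-- For `g` integrable on `[0, x₀]` with respect to `dm`, the Volterra–Stieltjes transform
`x ↦ ∫_{[0,x]} (x - t) g(t) dm(t)` is continuous on `[0, x₀]`. [folklore] -/
lemma continuousOn_integral_kernel {E : Type*} [NormedAddCommGroup E] [NormedSpace ℝ E] {x₀ : ℝ}
    {g : ℝ → E} (hg : IntegrableOn g (Icc 0 x₀) S.massMeasure) :
    ContinuousOn (fun x => ∫ t in Icc 0 x, (x - t) • g t ∂S.massMeasure) (Icc 0 x₀) := by
  have heq : EqOn (fun x => ∫ t in Icc 0 x₀, max (x - t) 0 • g t ∂S.massMeasure)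
      (fun x => ∫ t in Icc 0 x, (x - t) • g t ∂S.massMeasure) (Icc 0 x₀) := by
    intro x hx
    simp only
    rw [setIntegral_eq_of_subset_of_forall_sdiff_eq_zero measurableSet_Icc
      (Icc_subset_Icc_right hx.2)]
    · refine setIntegral_congr_fun measurableSet_Icc (fun t ht => ?_)
      simp [max_eq_left (sub_nonneg.2 ht.2)]
    · intro t ht
      have hxt : x < t := by
        by_contra h
        exact ht.2 ⟨ht.1.1, not_lt.mp h⟩
      simp [max_eq_right (sub_nonpos.2 hxt.le)]
  refine ContinuousOn.congr ?_ heq.symm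
  refine continuousOn_of_dominated (bound := fun t => x₀ * ‖g t‖) ?_ ?_ ?_ ?_
  · intro x _
    exact ((continuous_const.sub continuous_id).max continuous_const).aestronglyMeasurable.smul
      hg.aestronglyMeasurable
  · intro x hx
    refine ae_restrict_of_forall_mem measurableSet_Icc (fun t ht => ?_)
    rw [norm_smul, Real.norm_eq_abs, abs_of_nonneg (le_max_right _ _)]
    refine mul_le_mul_of_nonneg_right (max_le ?_ ?_) (norm_nonneg _)
    · linarith [hx.2, ht.1]
    · linarith [hx.1, hx.2]
  · exact hg.norm.const_mul x₀
  · refine Filter.Eventually.of_forall (fun t => ?_)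
    exact (((continuous_id.sub continuous_const).max continuous_const).smul
      continuous_const).continuousOn

/-- The Picard iterates of a function continuous on `[0, x₀]`, `x₀ ∈ [0, L)`, are continuous on
`[0, x₀]`. [folklore] -/
lemma continuousOn_picard {f : ℝ → ℝ} {x₀ : ℝ} (hx₀ : x₀ ∈ S.dom) (hf : ContinuousOn f (Icc 0 x₀))
    (n : ℕ) : ContinuousOn (S.picard f n) (Icc 0 x₀) := by
  induction n with
  | zero => simpa using hf
  | succ n ih =>
    have h := S.continuousOn_integral_kernel (S.integrableOn_Icc_of_continuousOn hx₀ ih)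
    simp only [smul_eq_mul] at h
    exact h

/-- Uniform bound for the terms of the Picard series on `[0, x₀]`. [folklore] -/
lemma norm_picard_term_le {f : ℝ → ℝ} {x₀ C : ℝ} (hx₀ : x₀ ∈ S.dom) (hC : ∀ s ∈ Icc 0 x₀, |f s| ≤ C)
    (z : ℂ) (n : ℕ) {s : ℝ} (hs : s ∈ Icc 0 x₀) :
    ‖(-z) ^ n * (S.picard f n s : ℂ)‖ ≤
      C * (‖z‖ * (S.massMeasure (Icc 0 x₀)).toReal * x₀) ^ n / n ! := by
  have hC0 : 0 ≤ C := (abs_nonneg _).trans (hC s hs)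
  have hM0 : 0 ≤ (S.massMeasure (Icc 0 x₀)).toReal := ENNReal.toReal_nonneg
  have hpow : ((S.massMeasure (Icc 0 x₀)).toReal * s) ^ n ≤
      ((S.massMeasure (Icc 0 x₀)).toReal * x₀) ^ n :=
    pow_le_pow_left₀ (mul_nonneg hM0 hs.1) (mul_le_mul_of_nonneg_left hs.2 hM0) n
  rw [norm_mul, norm_pow, norm_neg, Complex.norm_real, Real.norm_eq_abs]
  calc ‖z‖ ^ n * |S.picard f n s|
      ≤ ‖z‖ ^ n * (C * ((S.massMeasure (Icc 0 x₀)).toReal * s) ^ n / n !) :=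
        mul_le_mul_of_nonneg_left (S.abs_picard_le hx₀ hC n hs) (pow_nonneg (norm_nonneg _) _)
    _ ≤ ‖z‖ ^ n * (C * ((S.massMeasure (Icc 0 x₀)).toReal * x₀) ^ n / n !) := by
        gcongr
    _ = C * (‖z‖ * (S.massMeasure (Icc 0 x₀)).toReal * x₀) ^ n / n ! := by
        rw [mul_pow, mul_pow, mul_pow]; ring

/-- The Picard series `∑ₙ (-z)ⁿ (Kⁿf)(s)` converges (absolutely) at every `s ∈ [0, L)`.
[folklore] -/
lemma summable_picard_term {f : ℝ → ℝ} (hf : Continuous f) (z : ℂ) {s : ℝ} (hs : s ∈ S.dom) :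
    Summable (fun n => (-z) ^ n * (S.picard f n s : ℂ)) := by
  obtain ⟨C, hC⟩ := isCompact_Icc.exists_bound_of_continuousOn (hf.continuousOn (s := Icc 0 s))
  have hC' : ∀ t ∈ Icc 0 s, |f t| ≤ C := fun t ht => by simpa [Real.norm_eq_abs] using hC t ht
  refine Summable.of_norm_bounded ((Real.summable_pow_div_factorial
    (‖z‖ * (S.massMeasure (Icc 0 s)).toReal * s)).mul_left C) (fun n => ?_)
  simpa [mul_div_assoc] using S.norm_picard_term_le hs hC' z n ⟨hs.1, le_rfl⟩

/-- The Picard series is continuous on `[0, L)`. [folklore] -/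
lemma continuousOn_picardSeries {f : ℝ → ℝ} (hf : Continuous f) (z : ℂ) :
    ContinuousOn (fun x => ∑' n, (-z) ^ n * (S.picard f n x : ℂ)) S.dom := by
  have hIcc : ∀ x₀ ∈ S.dom,
      ContinuousOn (fun x => ∑' n, (-z) ^ n * (S.picard f n x : ℂ)) (Icc 0 x₀) := by
    intro x₀ hx₀
    obtain ⟨C, hC⟩ := isCompact_Icc.exists_bound_of_continuousOn (hf.continuousOn (s := Icc 0 x₀))
    have hC' : ∀ t ∈ Icc 0 x₀, |f t| ≤ C := fun t ht => by simpa [Real.norm_eq_abs] using hC t ht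
    refine continuousOn_tsum (fun n => ?_) ((Real.summable_pow_div_factorial
      (‖z‖ * (S.massMeasure (Icc 0 x₀)).toReal * x₀)).mul_left C) (fun n x hx => ?_)
    · exact continuousOn_const.mul
        (Complex.continuous_ofReal.comp_continuousOn (S.continuousOn_picard hx₀ hf.continuousOn n))
    · simpa [mul_div_assoc] using S.norm_picard_term_le hx₀ hC' z n hx
  intro x hx
  obtain ⟨x₀, hx₀, hxx₀⟩ := S.exists_mem_dom_gt hx
  refine ((hIcc x₀ hx₀).continuousWithinAt ⟨hx.1, hxx₀.le⟩).mono_of_mem_nhdsWithin ?_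
  exact mem_nhdsWithin.2 ⟨Iio x₀, isOpen_Iio, hxx₀, fun y hy => ⟨hy.2.1, le_of_lt hy.1⟩⟩

/-- The Picard series solves the string equation in integral form:
`Y(x) = f(x) - z ∫_{[0,x]} (x - t) Y(t) dm(t)` for `x ∈ [0, L)`. [folklore] -/
lemma picardSeries_eq {f : ℝ → ℝ} (hf : Continuous f) (z : ℂ) {x : ℝ} (hx : x ∈ S.dom) :
    ∑' n, (-z) ^ n * (S.picard f n x : ℂ) = (f x : ℂ) -
      z * ∫ t in Icc 0 x, ((x - t : ℝ) : ℂ) * (∑' n, (-z) ^ n * (S.picard f n t : ℂ))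
        ∂S.massMeasure := by
  set M := (S.massMeasure (Icc 0 x)).toReal with hM
  have hM0 : 0 ≤ M := ENNReal.toReal_nonneg
  have hx0 : 0 ≤ x := hx.1
  obtain ⟨C, hC⟩ := isCompact_Icc.exists_bound_of_continuousOn (hf.continuousOn (s := Icc 0 x))
  have hC' : ∀ t ∈ Icc 0 x, |f t| ≤ C := fun t ht => by simpa [Real.norm_eq_abs] using hC t ht
  have hC0 : 0 ≤ C := (abs_nonneg _).trans (hC' x ⟨hx.1, le_rfl⟩)
  haveI := S.isFiniteMeasure_restrict_Icc hx
  -- the terms of the series after the first, written as integrals of `F n`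
  set F : ℕ → ℝ → ℂ := fun n t => (-z) ^ (n + 1) * (((x - t : ℝ) : ℂ) * (S.picard f n t : ℂ))
    with hF
  have hF_int : ∀ n, IntegrableOn (F n) (Icc 0 x) S.massMeasure := by
    intro n
    refine S.integrableOn_Icc_of_continuousOn hx ?_
    exact continuousOn_const.mul ((Complex.continuous_ofReal.comp_continuousOn
      (continuousOn_const.sub continuousOn_id)).mul
      (Complex.continuous_ofReal.comp_continuousOn (S.continuousOn_picard hx hf.continuousOn n)))
  have hF_term : ∀ n, (-z) ^ (n + 1) * (S.picard f (n + 1) x : ℂ) =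
      ∫ t in Icc 0 x, F n t ∂S.massMeasure := by
    intro n
    simp only [hF]
    rw [integral_const_mul, picard_succ, ← integral_complex_ofReal]
    push_cast
    rfl
  have hF_norm : ∀ n, ∫ t in Icc 0 x, ‖F n t‖ ∂S.massMeasure ≤
      M * (‖z‖ * x * C * (‖z‖ * M * x) ^ n / n !) := by
    intro n
    have hb : ∀ t ∈ Icc 0 x, ‖F n t‖ ≤ ‖z‖ * x * C * (‖z‖ * M * x) ^ n / n ! := by
      intro t ht
      have ht0 : 0 ≤ t := ht.1
      simp only [hF]
      rw [norm_mul, norm_mul, norm_pow, norm_neg, Complex.norm_real, Complex.norm_real,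
        Real.norm_eq_abs, Real.norm_eq_abs, abs_of_nonneg (sub_nonneg.2 ht.2)]
      have h1 : |S.picard f n t| ≤ C * (M * x) ^ n / n ! := by
        have hpow : (M * t) ^ n ≤ (M * x) ^ n :=
          pow_le_pow_left₀ (mul_nonneg hM0 ht.1) (mul_le_mul_of_nonneg_left ht.2 hM0) n
        calc |S.picard f n t| ≤ C * (M * t) ^ n / n ! := S.abs_picard_le hx hC' n ht
          _ ≤ C * (M * x) ^ n / n ! := by gcongr
      have h2 : x - t ≤ x := by linarith
      calc ‖z‖ ^ (n + 1) * ((x - t) * |S.picard f n t|)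
          ≤ ‖z‖ ^ (n + 1) * (x * (C * (M * x) ^ n / n !)) :=
            mul_le_mul_of_nonneg_left (mul_le_mul h2 h1 (abs_nonneg _) hx0)
              (pow_nonneg (norm_nonneg _) _)
        _ = ‖z‖ * x * C * (‖z‖ * M * x) ^ n / n ! := by rw [mul_pow, mul_pow]; ring
    calc ∫ t in Icc 0 x, ‖F n t‖ ∂S.massMeasure
        ≤ ∫ _t in Icc 0 x, ‖z‖ * x * C * (‖z‖ * M * x) ^ n / n ! ∂S.massMeasure :=
          integral_mono_of_nonneg (Eventually.of_forall fun _ => norm_nonneg _)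
            (integrable_const _) (ae_restrict_of_forall_mem measurableSet_Icc hb)
      _ = M * (‖z‖ * x * C * (‖z‖ * M * x) ^ n / n !) := by
          rw [setIntegral_const, smul_eq_mul, measureReal_def]
  have hF_sum : Summable fun n => ∫ t in Icc 0 x, ‖F n t‖ ∂S.massMeasure := by
    refine Summable.of_nonneg_of_le (fun n => integral_nonneg fun _ => norm_nonneg _) hF_norm ?_
    refine ((Real.summable_pow_div_factorial (‖z‖ * M * x)).mul_left (M * (‖z‖ * x * C))).congr
      (fun n => ?_)
    ring
  have hsum : ∀ t ∈ Icc 0 x, Summable (fun n => (-z) ^ n * (S.picard f n t : ℂ)) :=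
    fun t ht => S.summable_picard_term hf z (S.Icc_subset_dom hx ht)
  calc ∑' n, (-z) ^ n * (S.picard f n x : ℂ)
      = (-z) ^ 0 * (S.picard f 0 x : ℂ) + ∑' n, (-z) ^ (n + 1) * (S.picard f (n + 1) x : ℂ) :=
        (hsum x ⟨hx.1, le_rfl⟩).tsum_eq_zero_add
    _ = (f x : ℂ) + ∑' n, ∫ t in Icc 0 x, F n t ∂S.massMeasure := by
        simp only [pow_zero, one_mul, picard_zero, hF_term]
    _ = (f x : ℂ) + ∫ t in Icc 0 x, (∑' n, F n t) ∂S.massMeasure := by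
        rw [integral_tsum_of_summable_integral_norm hF_int hF_sum]
    _ = (f x : ℂ) + ∫ t in Icc 0 x,
          (-z) * (((x - t : ℝ) : ℂ) * ∑' n, (-z) ^ n * (S.picard f n t : ℂ)) ∂S.massMeasure := by
        congr 1
        refine integral_congr_ae (Eventually.of_forall fun t => ?_)
        simp only [hF]
        rw [← tsum_mul_left, ← tsum_mul_left]
        exact tsum_congr (fun n => by ring)
    _ = (f x : ℂ) - z * ∫ t in Icc 0 x,
          ((x - t : ℝ) : ℂ) * (∑' n, (-z) ^ n * (S.picard f n t : ℂ)) ∂S.massMeasure := by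
        rw [integral_const_mul]; ring

/-- Unfolding of `KreinString.phi` as a Picard series. [folklore] -/
lemma phi_eq (z : ℂ) : S.phi z = fun x => ∑' n, (-z) ^ n * (S.picard (fun _ => (1 : ℝ)) n x : ℂ) :=
  rfl

/-- Unfolding of `KreinString.psi` as a Picard series. [folklore] -/
lemma psi_eq (z : ℂ) : S.psi z = fun x => ∑' n, (-z) ^ n * (S.picard (fun s => s) n x : ℂ) :=
  rfl

/-- `φ(·, z)` solves `dy' + z y dm = 0` with `φ(0) = 1`, `φ'(0-) = 0` (integral form). [folklore] -/
theorem isSolution_phi (z : ℂ) : S.IsSolution z 1 0 (S.phi z) := by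
  refine ⟨by rw [phi_eq]; exact S.continuousOn_picardSeries continuous_const z, fun x hx => ?_⟩
  have h := S.picardSeries_eq (f := fun _ => (1 : ℝ)) continuous_const z hx
  rw [phi_eq]
  simpa using h

/-- `ψ(·, z)` solves `dy' + z y dm = 0` with `ψ(0) = 0`, `ψ'(0-) = 1` (integral form). [folklore] -/
theorem isSolution_psi (z : ℂ) : S.IsSolution z 0 1 (S.psi z) := by
  refine ⟨by rw [psi_eq]; exact S.continuousOn_picardSeries continuous_id z, fun x hx => ?_⟩
  have h := S.picardSeries_eq (f := fun s => s) continuous_id z hx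
  rw [psi_eq]
  simpa using h

variable {S} in
/-- Uniqueness for the string equation in integral form: two continuous solutions with the same
initial data agree on `[0, L)` (Grönwall iteration). [folklore] -/
theorem IsSolution.eqOn {z y₀ y₀' : ℂ} {y₁ y₂ : ℝ → ℂ}
    (h₁ : S.IsSolution z y₀ y₀' y₁) (h₂ : S.IsSolution z y₀ y₀' y₂) : EqOn y₁ y₂ S.dom := by
  intro x hx
  set M := (S.massMeasure (Icc 0 x)).toReal with hM
  have hM0 : 0 ≤ M := ENNReal.toReal_nonneg
  set w : ℝ → ℂ := fun s => y₁ s - y₂ s with hw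
  have hw_cont : ContinuousOn w (Icc 0 x) :=
    (h₁.1.mono (S.Icc_subset_dom hx)).sub (h₂.1.mono (S.Icc_subset_dom hx))
  obtain ⟨W, hW⟩ := isCompact_Icc.exists_bound_of_continuousOn hw_cont
  have hW0 : 0 ≤ W := (norm_nonneg _).trans (hW x ⟨hx.1, le_rfl⟩)
  -- the homogeneous equation for `w`
  have hw_eq : ∀ s ∈ Icc 0 x, w s = -z * ∫ t in Icc 0 s, (s - t) • w t ∂S.massMeasure := by
    intro s hs
    have hsd : s ∈ S.dom := S.Icc_subset_dom hx hs
    have hint : ∀ {y : ℝ → ℂ}, ContinuousOn y S.dom →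
        IntegrableOn (fun t => ((s - t : ℝ) : ℂ) * y t) (Icc 0 s) S.massMeasure := by
      intro y hy
      refine S.integrableOn_Icc_of_continuousOn hsd ?_
      exact (Complex.continuous_ofReal.comp_continuousOn
        (continuousOn_const.sub continuousOn_id)).mul (hy.mono (S.Icc_subset_dom hsd))
    simp only [hw, Complex.real_smul, mul_sub]
    rw [integral_sub (hint h₁.1) (hint h₂.1), h₁.2 s hsd, h₂.2 s hsd]
    ring
  -- Grönwall iteration: `‖w s‖ ≤ W (‖z‖ M)ⁿ/n! · sⁿ` on `[0, x]`
  have hiter : ∀ n : ℕ, ∀ s ∈ Icc 0 x, ‖w s‖ ≤ W * (‖z‖ * M) ^ n / n ! * s ^ n := by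
    intro n
    induction n with
    | zero => intro s hs; simpa using hW s hs
    | succ n ih =>
      intro s hs
      have key :=
        S.norm_integral_kernel_le hx (K := W * (‖z‖ * M) ^ n / n !) (by positivity) n ih hs
      rw [hw_eq s hs, norm_mul, norm_neg]
      calc ‖z‖ * ‖∫ t in Icc 0 s, (s - t) • w t ∂S.massMeasure‖
          ≤ ‖z‖ * (W * (‖z‖ * M) ^ n / n ! * M * s ^ (n + 1) / (n + 1)) :=
            mul_le_mul_of_nonneg_left key (norm_nonneg _)
        _ = W * (‖z‖ * M) ^ (n + 1) / (n + 1)! * s ^ (n + 1) := by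
            rw [Nat.factorial_succ]; push_cast; field_simp; ring
  -- let `n → ∞`
  have hlim : Tendsto (fun n : ℕ => W * ((‖z‖ * M * x) ^ n / n !)) atTop (𝓝 (W * 0)) :=
    (FloorSemiring.tendsto_pow_div_factorial_atTop (‖z‖ * M * x)).const_mul W
  rw [mul_zero] at hlim
  have hle : ∀ n : ℕ, ‖w x‖ ≤ W * ((‖z‖ * M * x) ^ n / n !) := fun n => by
    calc ‖w x‖ ≤ W * (‖z‖ * M) ^ n / n ! * x ^ n := hiter n x ⟨hx.1, le_rfl⟩
      _ = W * ((‖z‖ * M * x) ^ n / n !) := by rw [mul_pow]; ring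
  have h0 : w x = 0 := norm_le_zero_iff.1 (ge_of_tendsto' hlim hle)
  simpa [hw, sub_eq_zero] using h0

end KreinString

/-- **Fundamental system of the string equation** — discharge of the named fact
`KreinStringFundamentalSystem`: for every Kreĭn string and every `z ∈ ℂ` the Picard series
`φ(·, z)`, `ψ(·, z)` solve `dy' + z y dm = 0` in integral form with `φ(0)=1, φ'(0-)=0`,
`ψ(0)=0, ψ'(0-)=1`, and a continuous solution is determined on `[0, L)` by its initial data.
Proof: Picard iteration for the Volterra–Stieltjes equation with the bound `|Kⁿf| ≤ C (m x)ⁿ/n!`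
(Kac–Kreĭn 1974 §1; Arov–Dym 2012 §2.6), Grönwall iteration for uniqueness. [folklore] -/
theorem KreinStringFundamentalSystem_holds : KreinStringFundamentalSystem :=
  fun S z => ⟨S.isSolution_phi z, S.isSolution_psi z, fun _ _ _ _ h₁ h₂ => h₁.eqOn h₂⟩


end Literature.Analysis.InverseSpectral

end
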